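import Mathlib
import Summits.Ventures.PercRepro2.Defs
import Summits.Ventures.PercRepro2.Graph
import Summits.Ventures.PercRepro2.Induced
import Summits.Ventures.PercRepro2.BHKAvoid
import Summits.Ventures.PercRepro2.YBridge
import Summits.Ventures.PercRepro2.K5Kernel

/-!
# `K₅` in the tree's vocabulary, and the bitmask connectivity is `Conn`
(blind cell PercRepro2, typer-1 g9; the first bridge file of the `K₅` certificate, `K5Kernel.lean`)

`ends5 : Fin 10 → Sym2 (Fin 5)` is `K₅` on the marks `o = 0, a₁ = 1, a₂ = 2, a₃ = 3, b = 4` with the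
edges in lexicographic order (`edge5`; `K5.ea`, `K5.eb` are its endpoints as numbers).
`conn_iff`: the bitmask closure `K5.conn ω u v` of `K5Kernel.lean` is exactly the tree's connection
relation `Conn ends5 ω u v` — the four closure steps `step` add the open neighbours of the reached
vertices (`testBit_step`, `testBit_nb`), so a reached vertex is reachable (`reachable_of_mem`) and every
vertex at walk distance `≤ 4` is reached (`mem_of_walk`); a path in a graph on five vertices has length
`≤ 4`.  Hence the eleven event tables of `K5Kernel.lean` are the indicators of the tree's events
(`tQ_iff`, …, `tABOL_iff`).
-/

namespace Summit.Ventures.PercRepro2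

namespace K5

/-! ## `K₅` as a graph of the tree -/

/-- The endpoints of the edges of `K₅` (lexicographic pairs). -/
def edge5 : Fin 10 → Fin 5 × Fin 5 :=
  ![(0, 1), (0, 2), (0, 3), (0, 4), (1, 2), (1, 3), (1, 4), (2, 3), (2, 4), (3, 4)]

/-- `K₅` on the five marks, in the tree's vocabulary. -/
def ends5 : Fin 10 → Sym2 (Fin 5) := fun e => s((edge5 e).1, (edge5 e).2)

/-- `ea` is the first endpoint. -/
lemma ea_eq (e : Fin 10) : ea e = ((edge5 e).1 : ℕ) := by fin_cases e <;> rfl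

/-- `eb` is the second endpoint. -/
lemma eb_eq (e : Fin 10) : eb e = ((edge5 e).2 : ℕ) := by fin_cases e <;> rfl

/-- The endpoints are distinct. -/
lemma ea_ne_eb (e : Fin 10) : ea e ≠ eb e := by fin_cases e <;> decide

/-- The endpoints are below `5`. -/
lemma ea_lt (e : Fin 10) : ea e < 5 := by fin_cases e <;> decide

/-- The endpoints are below `5`. -/
lemma eb_lt (e : Fin 10) : eb e < 5 := by fin_cases e <;> decide

/-- `ends5 e = s(x, y)` iff `{ea e, eb e} = {x, y}`. -/
lemma ends5_eq_iff (e : Fin 10) (x y : Fin 5) :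
    ends5 e = s(x, y) ↔ (ea e = x ∧ eb e = y) ∨ (eb e = x ∧ ea e = y) := by
  rw [ea_eq, eb_eq]
  unfold ends5
  rw [Sym2.eq_iff]
  constructor
  · rintro (⟨h1, h2⟩ | ⟨h1, h2⟩)
    · exact Or.inl ⟨by rw [h1], by rw [h2]⟩
    · exact Or.inr ⟨by rw [h2], by rw [h1]⟩
  · rintro (⟨h1, h2⟩ | ⟨h1, h2⟩)
    · exact Or.inl ⟨Fin.ext h1, Fin.ext h2⟩
    · exact Or.inr ⟨Fin.ext h2, Fin.ext h1⟩

/-! ## Bits of the closure -/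

/-- A fold of `lor`s: bit `v` of `l.foldl (· ||| h ·) acc` is bit `v` of `acc` or of some `h x`. -/
lemma testBit_foldl_lor {α : Type*} (h : α → ℕ) (v : ℕ) :
    ∀ (l : List α) (acc : ℕ),
      (l.foldl (fun acc x => acc ||| h x) acc).testBit v =
        (acc.testBit v || l.any fun x => (h x).testBit v)
  | [], acc => by simp
  | x :: l, acc => by
    rw [List.foldl_cons, testBit_foldl_lor h v l, Nat.testBit_lor, List.any_cons]
    simp only [Bool.or_assoc]

/-- The neighbour contribution of one edge. -/
def nbEdge (ω : Fin 10 → Bool) (u : ℕ) (e : Fin 10) : ℕ :=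
  if ω e then (if ea e = u then 1 <<< eb e else if eb e = u then 1 <<< ea e else 0) else 0

/-- `nb` is a fold of `lor`s of the edge contributions. -/
lemma nb_eq_foldl (ω : Fin 10 → Bool) (u : ℕ) :
    nb ω u = (List.finRange 10).foldl (fun acc e => acc ||| nbEdge ω u e) 0 := by
  unfold nb
  congr 1
  funext acc e
  unfold nbEdge
  split_ifs <;> simp

/-- Bit `v` of `1 <<< k` is `v = k`. -/
lemma testBit_one_shiftLeft (k v : ℕ) : (1 <<< k).testBit v = decide (k = v) := by
  rw [Nat.one_shiftLeft, Nat.testBit_two_pow]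

/-- **Bit `v` of the neighbour mask of `u`**: some open edge joins `u` and `v`. -/
lemma testBit_nb (ω : Fin 10 → Bool) (u v : ℕ) :
    (nb ω u).testBit v = true ↔
      ∃ e, ω e = true ∧ ((ea e = u ∧ eb e = v) ∨ (eb e = u ∧ ea e = v)) := by
  rw [nb_eq_foldl, testBit_foldl_lor, Nat.zero_testBit, Bool.false_or, List.any_eq_true]
  constructor
  · rintro ⟨e, -, he⟩
    unfold nbEdge at he
    refine ⟨e, ?_⟩
    by_cases hω : ω e = true
    · rw [if_pos hω] at he
      refine ⟨hω, ?_⟩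
      by_cases h1 : ea e = u
      · rw [if_pos h1, testBit_one_shiftLeft, decide_eq_true_iff] at he
        exact Or.inl ⟨h1, he⟩
      · rw [if_neg h1] at he
        by_cases h2 : eb e = u
        · rw [if_pos h2, testBit_one_shiftLeft, decide_eq_true_iff] at he
          exact Or.inr ⟨h2, he⟩
        · rw [if_neg h2, Nat.zero_testBit] at he
          exact absurd he Bool.false_ne_true
    · rw [if_neg hω, Nat.zero_testBit] at he
      exact absurd he Bool.false_ne_true
  · rintro ⟨e, hω, h⟩
    refine ⟨e, List.mem_finRange e, ?_⟩
    unfold nbEdge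
    rw [if_pos hω]
    rcases h with ⟨h1, h2⟩ | ⟨h1, h2⟩
    · rw [if_pos h1, testBit_one_shiftLeft, decide_eq_true_iff]; exact h2
    · have h3 : ea e ≠ u := fun h3 => ea_ne_eb e (h3.trans h1.symm)
      rw [if_neg h3, if_pos h1, testBit_one_shiftLeft, decide_eq_true_iff]; exact h2

/-- The contribution of one vertex to a closure step. -/
def stepV (ω : Fin 10 → Bool) (R : ℕ) (u : ℕ) : ℕ := if R.testBit u then nb ω u else 0

/-- `step` is a fold of `lor`s. -/
lemma step_eq_foldl (ω : Fin 10 → Bool) (R : ℕ) :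
    step ω R = (List.range 5).foldl (fun acc u => acc ||| stepV ω R u) R := by
  unfold step
  congr 1
  funext acc u
  unfold stepV
  split_ifs <;> simp

/-- **Bit `v` of a closure step**: `v` was reached, or some reached `u < 5` has `v` as an open
neighbour. -/
lemma testBit_step (ω : Fin 10 → Bool) (R : ℕ) (v : ℕ) :
    (step ω R).testBit v = true ↔
      R.testBit v = true ∨ ∃ u, u < 5 ∧ R.testBit u = true ∧ (nb ω u).testBit v = true := by
  rw [step_eq_foldl, testBit_foldl_lor, Bool.or_eq_true, List.any_eq_true]
  constructor
  · rintro (h | ⟨u, hu, h⟩)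
    · exact Or.inl h
    · unfold stepV at h
      by_cases hR : R.testBit u = true
      · rw [if_pos hR] at h
        exact Or.inr ⟨u, List.mem_range.1 hu, hR, h⟩
      · rw [if_neg hR, Nat.zero_testBit] at h
        exact absurd h Bool.false_ne_true
  · rintro (h | ⟨u, hu, hR, h⟩)
    · exact Or.inl h
    · refine Or.inr ⟨u, List.mem_range.2 hu, ?_⟩
      unfold stepV
      rw [if_pos hR]
      exact h

/-- Bits are preserved by a closure step. -/
lemma testBit_step_of_testBit (ω : Fin 10 → Bool) (R : ℕ) {v : ℕ} (h : R.testBit v = true) :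
    (step ω R).testBit v = true :=
  (testBit_step ω R v).2 (Or.inl h)

/-! ## The closure is reachability -/

/-- The iterated closure. -/
def reachN (ω : Fin 10 → Bool) (u : ℕ) : ℕ → ℕ
  | 0 => 1 <<< u
  | n + 1 => step ω (reachN ω u n)

/-- `reach` is the four-fold closure. -/
lemma reach_eq (ω : Fin 10 → Bool) (u : ℕ) : reach ω u = reachN ω u 4 := rfl

/-- The closures are increasing. -/
lemma testBit_reachN_succ (ω : Fin 10 → Bool) (u : ℕ) {n v : ℕ}
    (h : (reachN ω u n).testBit v = true) : (reachN ω u (n + 1)).testBit v = true :=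
  testBit_step_of_testBit ω _ h

/-- The closures are increasing (general form). -/
lemma testBit_reachN_of_le (ω : Fin 10 → Bool) (u : ℕ) {n m v : ℕ} (hnm : n ≤ m)
    (h : (reachN ω u n).testBit v = true) : (reachN ω u m).testBit v = true := by
  induction hnm with
  | refl => exact h
  | step _ ih => exact testBit_reachN_succ ω u ih

/-- An open neighbour of a reached vertex is reached one step later. -/
lemma testBit_reachN_succ_of_adj (ω : Fin 10 → Bool) (u : ℕ) {n : ℕ} {x y : Fin 5}
    (hx : (reachN ω u n).testBit x = true) (hxy : OpenAdj ends5 ω x y) :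
    (reachN ω u (n + 1)).testBit y = true := by
  refine (testBit_step ω _ y).2 (Or.inr ⟨x, x.isLt, hx, ?_⟩)
  rw [testBit_nb]
  obtain ⟨e, he, hends⟩ := hxy
  exact ⟨e, he, (ends5_eq_iff e x y).1 hends⟩

/-- Soundness: a reached vertex is connected to the root. -/
lemma reachable_of_mem (ω : Fin 10 → Bool) (u v : Fin 5) :
    ∀ {n : ℕ}, (reachN ω u n).testBit v = true → Conn ends5 ω u v
  | 0, h => by
    rw [reachN, testBit_one_shiftLeft, decide_eq_true_iff] at h
    rw [Fin.ext h]
    exact conn_refl ends5 ω v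
  | n + 1, h => by
    rw [reachN, testBit_step] at h
    rcases h with h | ⟨x, hx5, hx, hxv⟩
    · exact reachable_of_mem ω u v h
    · rw [testBit_nb] at hxv
      obtain ⟨e, he, hev⟩ := hxv
      have hadj : OpenAdj ends5 ω ⟨x, hx5⟩ v :=
        ⟨e, he, (ends5_eq_iff e ⟨x, hx5⟩ v).2 hev⟩
      have hne : (⟨x, hx5⟩ : Fin 5) ≠ v := by
        rintro rfl
        rcases hev with ⟨h1, h2⟩ | ⟨h1, h2⟩
        · exact ea_ne_eb e (h1.trans h2.symm)
        · exact ea_ne_eb e (h2.trans h1.symm)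
      exact (reachable_of_mem ω u ⟨x, hx5⟩ hx).trans
        ((openGraph_adj.2 ⟨hne, hadj⟩).reachable)

/-- Completeness along a walk: a walk of length `l` from a reached vertex ends in a vertex reached
`l` steps later. -/
lemma mem_of_walk (ω : Fin 10 → Bool) (u : ℕ) {x v : Fin 5} (p : (openGraph ends5 ω).Walk x v) :
    ∀ {n : ℕ}, (reachN ω u n).testBit x = true → (reachN ω u (n + p.length)).testBit v = true := by
  induction p with
  | nil => intro n hx; simpa using hx
  | cons hadj _ ih =>
    intro n hx
    have := ih (testBit_reachN_succ_of_adj ω u hx (openGraph_adj.1 hadj).2)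
    rw [SimpleGraph.Walk.length_cons, ← Nat.add_assoc]
    rwa [Nat.add_right_comm] at this

/-- **The bitmask closure is connectivity**: `conn ω u v = true ↔ Conn ends5 ω u v`. -/
theorem conn_iff (ω : Fin 10 → Bool) (u v : Fin 5) : conn ω u v = true ↔ Conn ends5 ω u v := by
  unfold conn
  rw [reach_eq]
  refine ⟨reachable_of_mem ω u v, fun h => ?_⟩
  refine h.elim_path fun p => ?_
  have hlen : p.1.length ≤ 4 := by
    have := p.2.length_lt
    rw [Fintype.card_fin] at this
    omega
  have hmem : (reachN ω u (0 + p.1.length)).testBit v = true :=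
    mem_of_walk ω u p.1 (by rw [reachN, testBit_one_shiftLeft]; simp)
  exact testBit_reachN_of_le ω u (by omega) hmem

/-- `conn` on numbers below `5`, for the tables. -/
lemma conn_iff' (ω : Fin 10 → Bool) {u v : ℕ} (hu : u < 5) (hv : v < 5) :
    conn ω u v = true ↔ Conn ends5 ω ⟨u, hu⟩ ⟨v, hv⟩ :=
  conn_iff ω ⟨u, hu⟩ ⟨v, hv⟩

/-! ## The event tables are the tree's events -/

/-- The connection `u ↔ v` for numerals, as a set membership. -/
lemma conn_iff_mem (ω : Fin 10 → Bool) {u v : ℕ} (hu : u < 5) (hv : v < 5) :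
    conn ω u v = true ↔ ω ∈ connEvent ends5 ⟨u, hu⟩ ⟨v, hv⟩ :=
  conn_iff' ω hu hv

/-- `tQ ω ↔ ω ∈ Q = {a₁ ↮ a₂}`. -/
lemma tQ_iff (ω : Fin 10 → Bool) : tQ ω = true ↔ ω ∈ avoidAll ends5 2 {1} := by
  unfold tQ
  rw [Bool.not_eq_true', Bool.eq_false_iff, Ne, conn_iff' ω (by norm_num) (by norm_num)]
  simp only [mem_avoidAll, Finset.mem_singleton, forall_eq]
  exact ⟨fun h hc => h (conn_symm hc), fun h hc => h (conn_symm hc)⟩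

/-- `tA ω ↔ ω ∈ Q ∩ {a₃ ∈ C₁}` (the case-1 world). -/
lemma tA_iff (ω : Fin 10 → Bool) :
    tA ω = true ↔ ω ∈ avoidAll ends5 2 {1} ∩ connEvent ends5 1 3 := by
  unfold tA
  rw [Bool.and_eq_true, tQ_iff, conn_iff_mem ω (by norm_num) (by norm_num)]
  exact Iff.rfl

/-- `tPD ω ↔ ω ∈ PD = Q ∩ {a₃ ∉ C₁ ∪ C₂}`. -/
lemma tPD_iff (ω : Fin 10 → Bool) : tPD ω = true ↔ ω ∈ PDEvent ends5 1 2 3 := by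
  unfold tPD PDEvent Dtilde UnionCluster.inU
  rw [Bool.and_eq_true, Bool.and_eq_true, tQ_iff, Bool.not_eq_true', Bool.not_eq_true',
    Bool.eq_false_iff, Bool.eq_false_iff, Ne, Ne, conn_iff' ω (by norm_num) (by norm_num),
    conn_iff' ω (by norm_num) (by norm_num)]
  simp only [mem_avoidAll, Finset.mem_singleton, forall_eq, Set.mem_inter_iff, Set.mem_compl_iff,
    Set.mem_union, mem_connEvent]
  constructor
  · rintro ⟨⟨hQ, h13⟩, h23⟩
    exact ⟨fun h => hQ (conn_symm h), fun h => h.elim (fun h => h13 (conn_symm h))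
      (fun h => h23 (conn_symm h))⟩
  · rintro ⟨hQ, h⟩
    exact ⟨⟨fun h' => hQ (conn_symm h'), fun h' => h (Or.inl (conn_symm h'))⟩,
      fun h' => h (Or.inr (conn_symm h'))⟩

/-- `tPDoU ω ↔ ω ∈ PD ∩ {o ∈ C₁ ∪ C₂}`. -/
lemma tPDoU_iff (ω : Fin 10 → Bool) :
    tPDoU ω = true ↔ ω ∈ PDEvent ends5 1 2 3 ∩ (connEvent ends5 1 0 ∪ connEvent ends5 2 0) := by
  unfold tPDoU
  rw [Bool.and_eq_true, tPD_iff, Bool.or_eq_true, conn_iff_mem ω (by norm_num) (by norm_num),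
    conn_iff_mem ω (by norm_num) (by norm_num)]
  exact Iff.rfl

/-- `tQB ω ↔ ω ∈ Q ∩ {b ∈ C₂}`. -/
lemma tQB_iff (ω : Fin 10 → Bool) :
    tQB ω = true ↔ ω ∈ avoidAll ends5 2 {1} ∩ connEvent ends5 2 4 := by
  unfold tQB
  rw [Bool.and_eq_true, tQ_iff, conn_iff_mem ω (by norm_num) (by norm_num)]
  exact Iff.rfl

/-- `tAO ω ↔ ω ∈ Q ∩ {a₃ ∈ C₁} ∩ {o ∈ C₂}`. -/
lemma tAO_iff (ω : Fin 10 → Bool) :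
    tAO ω = true ↔ ω ∈ avoidAll ends5 2 {1} ∩ connEvent ends5 1 3 ∩ connEvent ends5 2 0 := by
  unfold tAO
  rw [Bool.and_eq_true, tA_iff, conn_iff_mem ω (by norm_num) (by norm_num)]
  exact Iff.rfl

/-- `tAB ω ↔ ω ∈ Q ∩ {a₃ ∈ C₁} ∩ {b ∈ C₂}`. -/
lemma tAB_iff (ω : Fin 10 → Bool) :
    tAB ω = true ↔ ω ∈ avoidAll ends5 2 {1} ∩ connEvent ends5 1 3 ∩ connEvent ends5 2 4 := by
  unfold tAB
  rw [Bool.and_eq_true, tA_iff, conn_iff_mem ω (by norm_num) (by norm_num)]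
  exact Iff.rfl

/-- `tABO ω ↔ ω ∈ Q ∩ {a₃ ∈ C₁} ∩ {b ∈ C₂} ∩ {o ∈ C₂}` (the table's order). -/
lemma tABO_iff (ω : Fin 10 → Bool) :
    tABO ω = true ↔
      ω ∈ avoidAll ends5 2 {1} ∩ connEvent ends5 1 3 ∩ connEvent ends5 2 4 ∩ connEvent ends5 2 0 := by
  unfold tABO
  rw [Bool.and_eq_true, Bool.and_eq_true, tA_iff, conn_iff_mem ω (by norm_num) (by norm_num),
    conn_iff_mem ω (by norm_num) (by norm_num)]
  exact Iff.rfl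

/-- `tQBL ω ↔ ω ∈ Q ∩ {b ∈ C₁}`. -/
lemma tQBL_iff (ω : Fin 10 → Bool) :
    tQBL ω = true ↔ ω ∈ avoidAll ends5 2 {1} ∩ connEvent ends5 1 4 := by
  unfold tQBL
  rw [Bool.and_eq_true, tQ_iff, conn_iff_mem ω (by norm_num) (by norm_num)]
  exact Iff.rfl

/-- `tABL ω ↔ ω ∈ Q ∩ {a₃ ∈ C₁} ∩ {b ∈ C₁}`. -/
lemma tABL_iff (ω : Fin 10 → Bool) :
    tABL ω = true ↔ ω ∈ avoidAll ends5 2 {1} ∩ connEvent ends5 1 3 ∩ connEvent ends5 1 4 := by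
  unfold tABL
  rw [Bool.and_eq_true, tA_iff, conn_iff_mem ω (by norm_num) (by norm_num)]
  exact Iff.rfl

/-- `tABOL ω ↔ ω ∈ Q ∩ {a₃ ∈ C₁} ∩ {b ∈ C₁} ∩ {o ∈ C₂}` (the table's order). -/
lemma tABOL_iff (ω : Fin 10 → Bool) :
    tABOL ω = true ↔
      ω ∈ avoidAll ends5 2 {1} ∩ connEvent ends5 1 3 ∩ connEvent ends5 1 4 ∩ connEvent ends5 2 0 := by
  unfold tABOL
  rw [Bool.and_eq_true, Bool.and_eq_true, tA_iff, conn_iff_mem ω (by norm_num) (by norm_num),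
    conn_iff_mem ω (by norm_num) (by norm_num)]
  exact Iff.rfl

end K5

end Summit.Ventures.PercRepro2
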